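import Summits.CriticalPhenomena.CardyFormulaZ2.Theorems.CardyMagicRigidityNestingRigidityFiveArmZ2Audit
import Summits.CriticalPhenomena.CardyFormulaZ2.Theorems.CardyMagicRigidityNestingRigidityFiveArmUpperZ2
import Literature.Probability.Percolation.ZdFiveArmUniqueness
import HarnessLib

/-!
# Stub S6' `stub_dcmt2021_zdFiveArm` of line `pinch-resampling` v4 (crux `NestingRigidity`, stmt-CriticalPhenomena-4835):
# the fact `DuminilCopinManolescuTassion2021_zdFiveArm_upperBound` from its three remaining inputs

Helper module (proofs only; no `def`, no named fact) for the registered fact stub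
`stub_dcmt2021_zdFiveArm : Literature.Probability.Percolation.DuminilCopinManolescuTassion2021_zdFiveArm_upperBound`
(two-radii five-arm UPPER bound for critical bond percolation on `ℤ²`, cluster form `zdFiveArmClusters`).  The
deterministic half (U1) of the point upper bound — KSZ 1998 Lemma 5 (3.10)–(3.11) / Nolin 2008 Thm. 24: "the landed
five-arm event occurs for at most one vertex, hence `Σ_v P(A_v) ≤ 1`" — is LANDED for bond `ℤ²`
(`Literature/Probability/Percolation/ZdFiveArmUniqueness.lean`: `zdFiveArmKSZ`, `zdFiveArmKSZ_unique`,
`sum_real_zdFiveArmKSZ_le_one`, p154494).  This file wires it to the fact and thereby states, compiler-checked, the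
three inputs that remain (none is asserted; all are hypotheses):

* (U2) COMPARISON (KSZ (3.12) + Appendix to Lemma 5; Nolin Thm. 11 + Prop. 12; = Kesten's five-arm separation and
  extension on bond `ℤ²`, absent from the tree): for `N ≥ k` there are a square size `M` and `≥ N²` centres `v` with
  `c · P(𝒜₅(A_{k,N})) ≤ P(zdFiveArmKSZ M M v)`;
* (Q) LOWER quasi-multiplicativity of `𝒜₅` across `∂B(m)` (Kesten 1987; Nolin Prop. 17), absent for bond `ℤ²`;
* (L) the point LOWER bound `c'/m² ≤ P(𝒜₅(A_{k,m}))` (Nolin Thm. 24 (ii) lowest-crossing construction; in progress in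
  the tree's `ZdFiveArm*`/`LowestCrossing*` layers towards `Kesten1987_zdKestenRelation`).

Contents:
* `pointUpper_of_comparison` — **(U1) + (U2) ⇒ (U)**: `P(𝒜₅(A_{k,n})) ≤ (1/c)/n²` for `n ≥ k`
  (`N² c P ≤ Σ_{v ∈ V} P(zdFiveArmKSZ M M v) ≤ 1`);
* `dcmt2021_zdFiveArm_of_comparison` (registered anchor) — **(U2) + (Q) + (L) ⇒ the fact**, through
  `fiveArmUpperZ2_of_point_quasiMult` (audit file) and `fiveArmUpperZ2_iff_upperBound_one_le`.

References: H. Kesten, V. Sidoravicius, Y. Zhang, EJP 3 (1998), proof of Lemma 5; P. Nolin, EJP 13 (2008), §4–§5;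
H. Duminil-Copin, I. Manolescu, V. Tassion, PTRF 181 (2021), Prop. 6.3, 6.5, 6.6.
-/

noncomputable section

namespace Summit.CriticalPhenomena.CardyFormulaZ2.Cruxes.NestingRigidity.PinchResampling

open MeasureTheory Literature.Probability.Percolation Literature.Probability.LatticeModels

/-- **(U1) + (U2) ⇒ (U): the point upper bound from the comparison with the landed event.**  If for some `c > 0`
and every `N ≥ k` there are a square size `M` and a finite set `V` of at least `N²` vertices with
`c · P_{1/2}(𝒜₅(A_{k,N})) ≤ P_{1/2}(zdFiveArmKSZ M M v)` for all `v ∈ V`, then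
`P_{1/2}(𝒜₅(A_{k,n})) ≤ (1/c) / n²` for all `n ≥ k`: indeed `N² · c · P ≤ Σ_{v ∈ V} P(zdFiveArmKSZ M M v) ≤ 1` by
`sum_real_zdFiveArmKSZ_le_one` (KSZ 1998, (3.11)–(3.12) ⇒ (3.6)). -/
theorem pointUpper_of_comparison (k : ℕ)
    (h : ∃ c : ℝ, 0 < c ∧ ∀ N : ℕ, k ≤ N → ∃ (M : ℕ) (V : Finset (Site 2)), ((N : ℝ)) ^ 2 ≤ V.card ∧
      ∀ v ∈ V, c * (bondPercolation (zdGraph 2) half).real (zdFiveArmClusters k N) ≤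
        (bondPercolation (zdGraph 2) half).real (zdFiveArmKSZ M M v)) :
    ∃ C : ℝ, ∀ n : ℕ, k ≤ n →
      (bondPercolation (zdGraph 2) half).real (zdFiveArmClusters k n) ≤ C / (n : ℝ) ^ 2 := by
  obtain ⟨c, hc, h⟩ := h
  set μ := bondPercolation (zdGraph 2) half with hμ
  refine ⟨1 / c, fun n hn ↦ ?_⟩
  obtain ⟨M, V, hV, hv⟩ := h n hn
  set P := μ.real (zdFiveArmClusters k n) with hP
  have hP0 : 0 ≤ P := measureReal_nonneg
  -- `card V · (c P) ≤ Σ_v μ(KSZ v) ≤ 1`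
  have hsum : (V.card : ℝ) * (c * P) ≤ 1 := by
    calc (V.card : ℝ) * (c * P) = ∑ _v ∈ V, c * P := by rw [Finset.sum_const, nsmul_eq_mul]
      _ ≤ ∑ v ∈ V, μ.real (zdFiveArmKSZ M M v) := Finset.sum_le_sum hv
      _ ≤ 1 := sum_real_zdFiveArmKSZ_le_one μ M M V
  have hn2 : (n : ℝ) ^ 2 * (c * P) ≤ 1 :=
    (mul_le_mul_of_nonneg_right hV (mul_nonneg hc.le hP0)).trans hsum
  rcases Nat.eq_zero_or_pos n with rfl | hn0
  · -- `n = 0`: then `k = 0` and `𝒜₅(A_{0,0}) = ∅`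
    obtain rfl : k = 0 := Nat.le_zero.1 hn
    rw [hP, real_zdFiveArmClusters_zero_left]
    positivity
  · have hn' : (0 : ℝ) < (n : ℝ) ^ 2 := by positivity
    rw [le_div_iff₀ hn', le_div_iff₀ hc]
    calc P * (n : ℝ) ^ 2 * c = (n : ℝ) ^ 2 * (c * P) := by ring
      _ ≤ 1 := hn2

/-- **(U2) + (Q) + (L) ⇒ `DuminilCopinManolescuTassion2021_zdFiveArm_upperBound`** (registered anchor).  Fix an inner
radius `k`.  IF (U2) the comparison of `pointUpper_of_comparison` holds, (Q) the lower quasi-multiplicativity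
`c · P(𝒜₅(A_{k,m})) · P(𝒜₅(A_{m,n})) ≤ P(𝒜₅(A_{k,n}))` holds for `k ≤ m ≤ n`, and (L) the point lower bound
`c'/m² ≤ P(𝒜₅(A_{k,m}))` holds for `m ≥ k`, THEN the two-radii upper bound `P(𝒜₅(A_{r,R})) ≤ C (r/R)²` holds for
all `1 ≤ r ≤ R` (`fiveArmUpperZ2_of_point_quasiMult`, then `fiveArmUpperZ2_iff_upperBound_one_le`).  Nothing is
asserted: (U2), (Q), (L) are exactly what remains of the discharge of stub S6' after `ZdFiveArmUniqueness.lean`. -/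
theorem dcmt2021_zdFiveArm_of_comparison : ∀ k : ℕ, (∃ c : ℝ, 0 < c ∧ ∀ N : ℕ, k ≤ N → ∃ (M : ℕ) (V : Finset (Site 2)), ((N : ℝ)) ^ 2 ≤ V.card ∧ ∀ v ∈ V, c * (bondPercolation (zdGraph 2) half).real (zdFiveArmClusters k N) ≤ (bondPercolation (zdGraph 2) half).real (zdFiveArmKSZ M M v)) → (∃ c : ℝ, 0 < c ∧ ∀ m n : ℕ, k ≤ m → m ≤ n → c * (bondPercolation (zdGraph 2) half).real (zdFiveArmClusters k m) * (bondPercolation (zdGraph 2) half).real (zdFiveArmClusters m n) ≤ (bondPercolation (zdGraph 2) half).real (zdFiveArmClusters k n)) → (∃ c : ℝ, 0 < c ∧ ∀ m : ℕ, k ≤ m → c / (m : ℝ) ^ 2 ≤ (bondPercolation (zdGraph 2) half).real (zdFiveArmClusters k m)) → Literature.Probability.Percolation.DuminilCopinManolescuTassion2021_zdFiveArm_upperBound :=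
  fun k hU hQ hL ↦ fiveArmUpperZ2_iff_upperBound_one_le.1
    (fiveArmUpperZ2_of_point_quasiMult k (pointUpper_of_comparison k hU) hQ hL)

end Summit.CriticalPhenomena.CardyFormulaZ2.Cruxes.NestingRigidity.PinchResampling

end
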